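/-
Copyright: the b2b-balaban cell (near-miss cell 7), T⁴-continuum fan-out; row NE7b ROUND-2 swarm, seat
t4-ne7b-formalise-leaf-10 (gen 2; row S6g′(b) of `t4/b2b-balaban-t4-ne7b-p1/LEAVES-NE7b.md`, owner's ruling
R-OWNER-22-12 (2)).  Released under the licence of the surrounding project.
-/
import Summits.QuantumFields.BalabanUV.T4Continuum.Support.HistoryMassPlacement
import Summits.QuantumFields.BalabanUV.T4Continuum.Support.ZoneTorus

/-!
# Mass placement on the finite torus: the touch relation and its count (row S6g′(b), companion)

Summits-side support leaf of the T⁴-continuum cell (rung (B)+1 on a FINITE torus only; NOT infinite volume, NOT the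
mass gap, NOT the Clay statement; NOT a proof of the spine estimate NE7b).  Companion of `Support/HistoryMassPlacement`
(row S6g′(b), R-OWNER-22-12 (2)): the one-block TOUCH COUNT of the mass-form skeleton DISCHARGED on the cell's finite
torus model `ZoneTorus.TCell d (n·L^K)` — the mass-form analogue of `ZoneTorus.card_nearT_le` ∕ `NZT_le` ∕
`card_admZSet_root_le_torus`.  [folklore] finite combinatorics (blocks and residues, by `ZoneTorus.card_core_le`);
nothing is quoted from print, nothing printed is asserted, no `[cite:]` tag, no `Prop`-valued fact is minted (`touchT`
is a predicate with parameters, the model's nearness of a cell to a block); constants symbolic.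

WHAT.  §1 **`touchT n L K r t a y s`**: at level `t ≤ K`, the block `a` (a site of `(ℤ∕nL^{K−t})^d`, coordinates
`< n·L^{K−t}`) and a cell `y` of scale `s` whose level-`t` block `⌊y_i∕L^t⌋` is within cyclic distance `r` of `a_i` in
every coordinate; the count **`card_touchT_le`**: `#{y : touchT n L K r t a y s} ≤ NTT d L r t s = ((2r+1)·L^{t∸s})^d`;
the fibre shape **`NTT_le`**: `NTT d L r t s ≤ (2r+1)^d·(L^d)^{t+1−s}`.  §2 **`card_admMSet_root_le_torus`**: the
assembled mass-form multiplicity bound of `HistoryMassPlacement.card_admMSet_root_le` with cells `TCell d (n·L^K)`,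
blocks `Fin d → ℕ`, touch `touchT n L K (ρ e) (st e)` (a per-merger radius `ρ e`: a constant contact radius for a bare
birth, `ρ + ext` for a composite free partner — the binding's choice) and the touch count DISCHARGED; displayed: the
attachable sets (`hloc`, `hcard`) with `(2ρ e+1)^d·zmass e Z ≤ f (merge X Y e) e` at well-formed merge nodes; conclusion
`#admMSet G root c c₀′ ≤ (L^d)^{partnerAges st G}·mergeProd f G`.  §3 sanity (decided arithmetic).

HONEST.  Rows S6g′(a) (the cardinality law feeding `hcard`) and S6g′(c) (symmetrisation) are not here; nothing of H3 ∕
(B) ∕ BetaPertH.  NE7b NOT proved.  HONEST DEPENDENCY (cell): continuum YM on T⁴ ⇐ BetaPertH ∧ nine spine estimates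
(0/9 proved); BetaPertH ⇐ (D1) ∧ (D4) ∧ CAP+tail; G-an2-4 gates asym, D1 and NE2/3/4.  This file changes none of it.
-/

open Finset
open Literature.MathematicalPhysics.QuantumFieldTheory.Balaban1983to89
open T4PersistenceDictionary T4PartnerMultiplicity
open Summit.QuantumFields.BalabanUV.T4Continuum.PlacementSkeleton
open Summit.QuantumFields.BalabanUV.T4Continuum.ZoneSkeleton
open Summit.QuantumFields.BalabanUV.T4Continuum.ZoneTorus
open Summit.QuantumFields.BalabanUV.T4Continuum.HistoryMassPlacement

namespace Summit.QuantumFields.BalabanUV.T4Continuum.HistoryMassPlacement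

noncomputable section

variable {d : ℕ}

/-! ## §1 The touch relation on the finite torus and its count -/

/-- **TOUCH ON THE TORUS**: at level `t ≤ K`, the block `a` (coordinates `< n·L^{K−t}`, a site of `(ℤ∕nL^{K−t})^d`)
and a cell `y` of scale `s` whose level-`t` block `⌊y_i∕L^t⌋` is within cyclic distance `r` of `a_i` in every
coordinate (sup-metric). [folklore] -/
def touchT (n L K r t : ℕ) (a : Fin d → ℕ) (y : TCell d (n * L ^ K)) (s : ℕ) : Prop :=
  t ≤ K ∧ IsScale L s y ∧ (∀ i, a i < n * L ^ (K - t)) ∧ ∀ i, cycd (n * L ^ (K - t)) (a i) ((y i).val / L ^ t) ≤ r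

/-- THE TOUCH COUNT of the torus model: `((2r+1)·L^{t∸s})^d` (blocks at cyclic sup-distance `≤ r` times the blocking
fibre on the scale-`s` cells; independent of `n`, `K`). [folklore] -/
def NTT (d L r t s : ℕ) : ℕ := ((2 * r + 1) * L ^ (t - s)) ^ d

section TorusCount

open scoped Classical

/-- **THE ONE-BLOCK TOUCH COUNT ON THE TORUS**: for a fixed block `a`, the cells `y` with `touchT n L K r t a y s`
number at most `NTT d L r t s`. [folklore] -/
theorem card_touchT_le (n : ℕ) {L : ℕ} (hL : 1 ≤ L) (K r t : ℕ) (a : Fin d → ℕ) (s : ℕ) :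
    ((univ : Finset (TCell d (n * L ^ K))).filter fun y => touchT n L K r t a y s).card ≤ NTT d L r t s := by
  by_cases h : t ≤ K ∧ ∀ i, a i < n * L ^ (K - t)
  · obtain ⟨htK, ha⟩ := h
    have hN : n * L ^ K = n * L ^ (K - t) * L ^ t := by rw [mul_assoc, ← pow_add, Nat.sub_add_cancel htK]
    refine le_trans (card_le_card ?_) (card_core_le hL hN a ha s r)
    intro y hy
    obtain ⟨-, hys, -, hyd⟩ := (mem_filter.1 hy).2
    exact mem_filter.2 ⟨mem_univ _, hys, hyd⟩
  · rw [filter_false_of_mem fun y _ hy => h ⟨hy.1, hy.2.2.1⟩, card_empty]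
    exact Nat.zero_le _

end TorusCount

/-- **THE FIBRE SHAPE OF THE TOUCH COUNT**: `NTT d L r t s ≤ (2r+1)^d·(L^d)^{t+1−s}` (`L ≥ 1`; the spare factor
`Λ = L^d` is the chain's convention `partnerAges = Σ (t + 1 − s)`). [folklore] -/
theorem NTT_le {L : ℕ} (hL : 1 ≤ L) (d r t s : ℕ) :
    (NTT d L r t s : ℝ) ≤ ((2 : ℝ) * r + 1) ^ d * ((L : ℝ) ^ d) ^ (t + 1 - s) := by
  unfold NTT
  push_cast
  rw [mul_pow, pow_right_comm]
  have hL1 : (1 : ℝ) ≤ (L : ℝ) ^ d := one_le_pow₀ (by exact_mod_cast hL)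
  exact mul_le_mul_of_nonneg_left (pow_le_pow_right₀ hL1 (by omega)) (by positivity)

/-! ## §2 The mass-form multiplicity on the finite torus -/

section Torus

variable {ε : Type*} [DecidableEq ε] [Fintype ε]

open scoped Classical

/-- **THE MASS-FORM MULTIPLICITY ON THE FINITE TORUS.**  Cells `TCell d (n·L^K)`, blocks `Fin d → ℕ`, touch
`touchT n L K (ρ e) (st e)` with a per-merger radius `ρ e`, touch count DISCHARGED (`card_touchT_le`, `NTT_le`);
displayed: the attachable sets (local, `hloc`) with their cardinality majorant on admissible placements (`hcard`),
dominated at well-formed merge nodes by `zmass e Z·(2ρ e+1)^d ≤ f (merge X Y e) e` (`Z` either partner).  Then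
`#admMSet G root c c₀′ ≤ (L^d)^{partnerAges st G}·mergeProd f G`. [folklore] -/
theorem card_admMSet_root_le_torus (W : ε → ℕ) (n : ℕ) {L : ℕ} (hL : 1 ≤ L) (K : ℕ)
    (zoneP : ε → Gen ε → (ε → TCell d (n * L ^ K)) → Finset (Fin d → ℕ))
    (hloc : ∀ (e : ε) (Z : Gen ε) (P P' : ε → TCell d (n * L ^ K)), (∀ b ∈ births Z, P b = P' b) →
      zoneP e Z P = zoneP e Z P')
    (ρ st : ε → ℕ) (zmass : ε → Gen ε → ℕ)
    (hcard : ∀ (e : ε) (Z : Gen ε) (P : ε → TCell d (n * L ^ K)),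
      AdmM zoneP (fun e => touchT n L K (ρ e) (st e)) Z P → (zoneP e Z P).card ≤ zmass e Z)
    (f : Gen ε → ε → ℝ) (hf : ∀ X Y e, 0 ≤ f (Gen.merge X Y e) e)
    (hzm : ∀ (X Y : Gen ε) (e : ε), (Gen.merge X Y e).WF W →
      (zmass e X : ℝ) * ((2 : ℝ) * ρ e + 1) ^ d ≤ f (Gen.merge X Y e) e ∧
        (zmass e Y : ℝ) * ((2 : ℝ) * ρ e + 1) ^ d ≤ f (Gen.merge X Y e) e)
    {G : Gen ε} (hW : G.WF W) (c c₀' : TCell d (n * L ^ K)) :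
    ((admMSet zoneP (fun e => touchT n L K (ρ e) (st e)) G G.root c c₀').card : ℝ) ≤
      ((L : ℝ) ^ d) ^ partnerAges st G * mergeProd f G :=
  card_admMSet_root_le W zoneP hloc (fun e => touchT n L K (ρ e) (st e)) zmass (fun e s => NTT d L (ρ e) (st e) s)
    hcard (fun e a s => card_touchT_le n hL K (ρ e) (st e) a s) st (by positivity)
    (fun e => ((2 : ℝ) * ρ e + 1) ^ d) (fun e s => NTT_le hL d (ρ e) (st e) s) f hf hzm hW c c₀'

/-- **THE CROWD FORM ON THE TORUS, EXPONENT ONE.**  A CONSTANT contact radius `ρ` and the cardinality majorant dominated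
by `Cz` times the merged structure's discounted weighted activity:
`#admMSet G root c c₀′ ≤ (L^d)^{partnerAges st G}·((2ρ+1)^d·Cz)^{mergeCount G}·mergeProd q_Z G`. [folklore] -/
theorem card_admMSet_root_le_torus_crowd (W : ε → ℕ) (n : ℕ) {L : ℕ} (hL : 1 ≤ L) (K : ℕ)
    (zoneP : ε → Gen ε → (ε → TCell d (n * L ^ K)) → Finset (Fin d → ℕ))
    (hloc : ∀ (e : ε) (Z : Gen ε) (P P' : ε → TCell d (n * L ^ K)), (∀ b ∈ births Z, P b = P' b) →
      zoneP e Z P = zoneP e Z P')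
    (ρ : ℕ) (st : ε → ℕ) (zmass : ε → Gen ε → ℕ)
    (hcard : ∀ (e : ε) (Z : Gen ε) (P : ε → TCell d (n * L ^ K)),
      AdmM zoneP (fun e => touchT n L K ρ (st e)) Z P → (zoneP e Z P).card ≤ zmass e Z)
    {Cz σ : ℝ} (hCz : 0 ≤ Cz) (hσ : 0 ≤ σ) (wt : ε → ℝ) (hwt : ∀ w, 0 ≤ wt w)
    (hzm : ∀ (X Y : Gen ε) (e : ε), (Gen.merge X Y e).WF W →
      (zmass e X : ℝ) ≤ Cz * qZ wt σ st (Gen.merge X Y e) (st e) ∧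
        (zmass e Y : ℝ) ≤ Cz * qZ wt σ st (Gen.merge X Y e) (st e))
    {G : Gen ε} (hW : G.WF W) (c c₀' : TCell d (n * L ^ K)) :
    ((admMSet zoneP (fun e => touchT n L K ρ (st e)) G G.root c c₀').card : ℝ) ≤
      ((L : ℝ) ^ d) ^ partnerAges st G *
        ((((2 : ℝ) * ρ + 1) ^ d * Cz) ^ mergeCount G * mergeProd (fun Z e => qZ wt σ st Z (st e)) G) :=
  card_admMSet_root_le_crowd W zoneP hloc (fun e => touchT n L K ρ (st e)) zmass (fun e s => NTT d L ρ (st e) s)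
    hcard (fun e a s => card_touchT_le n hL K ρ (st e) a s) st (by positivity) (by positivity) hCz hσ
    (fun e s => NTT_le hL d ρ (st e) s) wt hwt hzm hW c c₀'

end Torus

/-! ## §3 Sanity (decided arithmetic) -/

namespace Sanity

/-- the torus touch count at `d = 4`, `L = 13`, contact radius `2`, levels `t = 7`, `s = 5`: `(5·13²)^4` cells [folklore] -/
example : NTT 4 13 2 7 5 = (5 * 13 ^ 2) ^ 4 := by simp [NTT]

/-- at equal levels the blocking fibre is trivial: `NTT d L r t t = (2r+1)^d` [folklore] -/
example (d L r t : ℕ) : NTT d L r t t = (2 * r + 1) ^ d := by simp [NTT]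

end Sanity

end

end Summit.QuantumFields.BalabanUV.T4Continuum.HistoryMassPlacement
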